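import Summits.AtomisticToContinuum.HydrodynamicLimit.Theses.ExpTailStaging

/-!
# Strategist (redirect r1) records for the crux `ExpVelocityMomentBound` (stmt-AtomisticToContinuum-11518)

Typed, sorry-free companions of `STRATEGY-CENSUS.md` (crux-strategist REDIRECT r1, 2026-08-17).  Nothing here is a
line or a stub and the crux decl is untouched.  Contents:

* §0 `K1PreShock` — the refuters' Euler/LLN-guarded pre-shock repair C′ of the crux (shape of `Cprime.lean` /
  `Repair11518.lean` on the item; verbatim the hypothesis frame of the shared cubic item `EnergyCurrentTails`,
  stmt-9235), with `k1PreShock_of_expVelocityMomentBound` (K1 as typed ⇒ C′: the repair loses nothing a consumer on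
  `[0, t]`, `t < T`, uses);
* §1 THE DOMINANCE CHAIN used by the census verdict: `energyCurrentTails_of_k1PreShock` (C′ ⇒ `EnergyCurrentTails`)
  and `expRateGivesCubicUI` — a sorry-free proof of the route's support item `ExpTailStaging.ExpRateGivesCubicUI`
  (stmt-11520, "provable now"): K1 ⇒ EnergyCurrentTails (9235), whose strategist censuses (gen1 02:17Z, s2 13:50Z)
  already place that WEAKER statement at the one-rare-participant contact core of the summit.  Pointwise input:
  `|v|³ 𝟙{|v| > M} ≤ δ e^{κ|v|}` for `M ≥ max 1 (24/(δκ⁴))` (from `x⁴/4! ≤ eˣ`), then monotonicity/linearity of `∫⁻`;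
* §2 NEGATION SHAPE: `PostShockWitness`, the exact form a disprover must instantiate to refute K1 AS TYPED (all
  horizons `T`, no Euler tie), with `not_expVelocityMomentBound_of_postShockWitness` (proved).  The converging-shock
  (Guderley) focusing profile of the census § Negation is a physical, uncertified instance.
-/

noncomputable section

namespace Summit.AtomisticToContinuum.HydrodynamicLimit.Cruxes.ExpVelocityMomentBound.StrategistR1

open MeasureTheory Set Filter
open scoped ENNReal BigOperators
open Literature.MathematicalPhysics.KineticTheory Literature.Analysis.FluidPDE
open Summit.AtomisticToContinuum.HydrodynamicLimit.Theses.ExpTailStaging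

/-! ## §0 The pre-shock repair C′ and `K1 ⇒ C′` -/

/-- **C′ = K1′, the Euler/LLN-guarded pre-shock form of the crux** (refuters' repair, 2026-08-15): along a classical
hard-sphere Euler solution on `[0, T)` whose `t = 0` fields are the local-Gibbs LLN limits, for every `t < T` ONE
exponential velocity-moment rate holds uniformly in `N ≥ N₀` and `s ∈ [0, t]`.  Verbatim the hypothesis frame of
`ExpTailStaging.EnergyCurrentTails` (stmt-9235). -/
def K1PreShock : Prop :=
  ∀ (a₀ θ₀ : T3 → ℝ) (u₀ : T3 → V3), Continuous a₀ → Continuous θ₀ → Continuous u₀ → (∀ x, 0 < a₀ x) →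
    (∀ x, 0 < θ₀ x) → ∃ σ₀ : ℝ, 0 < σ₀ ∧ ∀ σ : ℝ, 0 < σ → σ < σ₀ →
      ∀ (T : ℝ) (ρ θ : ℝ → T3 → ℝ) (u : ℝ → T3 → V3), IsHardSphereEulerSolution σ T ρ u θ →
        ∀ Φ : (N : ℕ) → HardSphereFlow (Torus.geometry (Fin 3)) (hsDiameter σ N) (N + 1),
          TendstoHydroFieldsAt (fun N => localGibbsLaw σ a₀ u₀ θ₀ N (Φ N)) Φ ρ u θ 0 →
            ∀ t ∈ Set.Ico 0 T, ∃ κ : ℝ, 0 < κ ∧ ∃ C : ℝ, ∃ N₀ : ℕ, ∀ N : ℕ, N₀ ≤ N → ∀ s ∈ Set.Icc 0 t,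
              ∫⁻ z, ENNReal.ofReal (((N : ℝ) + 1)⁻¹ * ∑ i : Fin (N + 1),
                Real.exp (κ * ‖((Φ N).flow s z i).2‖)) ∂(localGibbsLaw σ a₀ u₀ θ₀ N (Φ N)) ≤ ENNReal.ofReal C

/-- **K1 as typed implies its pre-shock repair C′** (apply K1 with horizon `t + 1`; the Euler solution and the
LLN hypothesis are discarded).  So a 1:1 `--restate` K1 ↦ C′ costs the route nothing. -/
theorem k1PreShock_of_expVelocityMomentBound (h : ExpVelocityMomentBound) : K1PreShock := by
  intro a₀ θ₀ u₀ ha hθ hu hap hθp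
  obtain ⟨σ₀, hσ₀, H⟩ := h a₀ θ₀ u₀ ha hθ hu hap hθp
  refine ⟨σ₀, hσ₀, fun σ hσ hσ' T ρ θ u _hsol Φ _h0 t ht => ?_⟩
  obtain ⟨κ, hκ, C, N₀, hC⟩ := H σ hσ hσ' (t + 1) (by linarith [ht.1]) Φ
  exact ⟨κ, hκ, C, N₀, fun N hN s hs => hC N hN s ⟨hs.1, by linarith [hs.2]⟩⟩

/-! ## §1 The dominance chain `K1 ⇒ C′ ⇒ EnergyCurrentTails (9235)` -/

/-- Exponential domination of the cubic tail: for `κ, δ > 0` and `r > max 1 (24/(δκ⁴))`, `r³ ≤ δ exp(κ r)`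
(from `x⁴/24 ≤ eˣ` at `x = κ r`). -/
theorem cube_le_mul_exp_of_lt {κ δ r : ℝ} (hκ : 0 < κ) (hδ : 0 < δ)
    (hr : max 1 (24 / (δ * κ ^ 4)) < r) : r ^ 3 ≤ δ * Real.exp (κ * r) := by
  have h1 : 1 < r := lt_of_le_of_lt (le_max_left _ _) hr
  have h2 : 24 / (δ * κ ^ 4) < r := lt_of_le_of_lt (le_max_right _ _) hr
  have hdc : 0 < δ * κ ^ 4 := by positivity
  have hkey : 24 < δ * κ ^ 4 * r := by
    rw [div_lt_iff₀ hdc] at h2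
    linarith
  have hr0 : 0 < r := by linarith
  have hexp : (κ * r) ^ 4 / 24 ≤ Real.exp (κ * r) := by
    have h := Real.pow_div_factorial_le_exp (x := κ * r) (by positivity) 4
    simpa [Nat.factorial] using h
  calc r ^ 3 = 1 * r ^ 3 := (one_mul _).symm
    _ ≤ (δ * κ ^ 4 * r / 24) * r ^ 3 := by gcongr; linarith
    _ = δ * ((κ * r) ^ 4 / 24) := by ring
    _ ≤ δ * Real.exp (κ * r) := by gcongr

/-- Indicator form: the cubic tail at the exponential cut-off is below `δ e^{κ|v|}` everywhere. -/
theorem indicator_cube_le_mul_exp {κ δ : ℝ} (hκ : 0 < κ) (hδ : 0 < δ) (v : V3) :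
    Set.indicator {w : V3 | max 1 (24 / (δ * κ ^ 4)) < ‖w‖} (fun w => ‖w‖ ^ 3) v ≤
      δ * Real.exp (κ * ‖v‖) := by
  by_cases hv : max 1 (24 / (δ * κ ^ 4)) < ‖v‖
  · rw [Set.indicator_of_mem (show v ∈ {w : V3 | max 1 (24 / (δ * κ ^ 4)) < ‖w‖} from hv)]
    exact cube_le_mul_exp_of_lt hκ hδ hv
  · rw [Set.indicator_of_notMem (show v ∉ {w : V3 | max 1 (24 / (δ * κ ^ 4)) < ‖w‖} from hv)]
    positivity

/-- **C′ ⇒ `EnergyCurrentTails`** (the route's decl of the shared cubic item stmt-9235).  At `(t, ε)` take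
`κ, C, N₀` from C′ at `t`, put `δ = ε/(max C 0 + 1)` and `M = max 1 (24/(δκ⁴))`; pointwise
`|v|³𝟙{|v| > M} ≤ δe^{κ|v|}`, so the lower integral is at most `δ · C ≤ ε`. -/
theorem energyCurrentTails_of_k1PreShock (h : K1PreShock) : EnergyCurrentTails := by
  intro a₀ θ₀ u₀ ha hθ hu ha0 hθ0
  obtain ⟨σ₀, hσ₀, hσ⟩ := h a₀ θ₀ u₀ ha hθ hu ha0 hθ0
  refine ⟨σ₀, hσ₀, fun σ hσp hσl T ρ θ u hE Φ hLLN t ht ε hε => ?_⟩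
  obtain ⟨κ, hκ, C, N₀, hb⟩ := hσ σ hσp hσl T ρ θ u hE Φ hLLN t ht
  set δ : ℝ := ε / (max C 0 + 1) with hδ
  have hC1 : 0 < max C 0 + 1 := by positivity
  have hδpos : 0 < δ := div_pos hε hC1
  have hδC : δ * C ≤ ε := by
    calc δ * C ≤ δ * (max C 0 + 1) := by
          refine mul_le_mul_of_nonneg_left ?_ hδpos.le
          linarith [le_max_left C 0]
      _ = ε := by rw [hδ, div_mul_cancel₀ _ hC1.ne']
  refine ⟨max 1 (24 / (δ * κ ^ 4)), N₀, fun N hN s hs => ?_⟩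
  have hpt : ∀ z : Config (N + 1) (Fin 3) T3,
      ENNReal.ofReal (((N : ℝ) + 1)⁻¹ * ∑ i : Fin (N + 1),
        Set.indicator {v : V3 | max 1 (24 / (δ * κ ^ 4)) < ‖v‖} (fun v => ‖v‖ ^ 3)
          (((Φ N).flow s z i).2)) ≤
      ENNReal.ofReal δ * ENNReal.ofReal (((N : ℝ) + 1)⁻¹ * ∑ i : Fin (N + 1),
        Real.exp (κ * ‖((Φ N).flow s z i).2‖)) := by
    intro z
    rw [← ENNReal.ofReal_mul hδpos.le]
    refine ENNReal.ofReal_le_ofReal ?_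
    calc ((N : ℝ) + 1)⁻¹ * ∑ i : Fin (N + 1),
          Set.indicator {v : V3 | max 1 (24 / (δ * κ ^ 4)) < ‖v‖} (fun v => ‖v‖ ^ 3)
            (((Φ N).flow s z i).2)
        ≤ ((N : ℝ) + 1)⁻¹ * ∑ i : Fin (N + 1), δ * Real.exp (κ * ‖((Φ N).flow s z i).2‖) :=
          mul_le_mul_of_nonneg_left
            (Finset.sum_le_sum fun i _ => indicator_cube_le_mul_exp hκ hδpos _) (by positivity)
      _ = δ * (((N : ℝ) + 1)⁻¹ * ∑ i : Fin (N + 1), Real.exp (κ * ‖((Φ N).flow s z i).2‖)) := by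
          rw [← Finset.mul_sum]
          ring
  calc ∫⁻ z, ENNReal.ofReal (((N : ℝ) + 1)⁻¹ * ∑ i : Fin (N + 1),
          Set.indicator {v : V3 | max 1 (24 / (δ * κ ^ 4)) < ‖v‖} (fun v => ‖v‖ ^ 3)
            (((Φ N).flow s z i).2)) ∂(localGibbsLaw σ a₀ u₀ θ₀ N (Φ N))
      ≤ ∫⁻ z, ENNReal.ofReal δ * ENNReal.ofReal (((N : ℝ) + 1)⁻¹ * ∑ i : Fin (N + 1),
          Real.exp (κ * ‖((Φ N).flow s z i).2‖)) ∂(localGibbsLaw σ a₀ u₀ θ₀ N (Φ N)) :=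
        lintegral_mono (hpt ·)
    _ = ENNReal.ofReal δ * ∫⁻ z, ENNReal.ofReal (((N : ℝ) + 1)⁻¹ * ∑ i : Fin (N + 1),
          Real.exp (κ * ‖((Φ N).flow s z i).2‖)) ∂(localGibbsLaw σ a₀ u₀ θ₀ N (Φ N)) :=
        lintegral_const_mul' _ _ ENNReal.ofReal_ne_top
    _ ≤ ENNReal.ofReal δ * ENNReal.ofReal C := mul_le_mul' le_rfl (hb N hN s hs)
    _ = ENNReal.ofReal (δ * C) := (ENNReal.ofReal_mul hδpos.le).symm
    _ ≤ ENNReal.ofReal ε := ENNReal.ofReal_le_ofReal hδC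

/-- **K1 ⇒ `EnergyCurrentTails`** — a sorry-free proof of the route's support item
`ExpTailStaging.ExpRateGivesCubicUI` (stmt-AtomisticToContinuum-11520): the crux dominates the shared cubic crux
stmt-9235 (strategist censuses of 9235: no-strategy-short-of-summit gen1; s2 one level down). -/
theorem expRateGivesCubicUI : ExpRateGivesCubicUI :=
  fun h => energyCurrentTails_of_k1PreShock (k1PreShock_of_expVelocityMomentBound h)

/-! ## §2 Negation: the shape of a refuting witness for K1 AS TYPED (all horizons, no Euler tie) -/

/-- **Post-shock witness shape.** One admissible profile triple (continuous, `a₀, θ₀ > 0`) such that for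
arbitrarily small `σ` there are a horizon `T` and a flow family along which, for EVERY rate `κ > 0`, every `C`
and every `N₀`, some `N ≥ N₀` and `t ≤ T` violate the bound.  The converging-shock focusing datum of the census
(§ Negation N1: Guderley collapse at `t* < T`, focal temperature `θ_peak(N) → ∞` carried by an `N`-independent
number `≍ σ⁻⁶` of spheres, empirical exponential moment `≳ σ⁻⁶ e^{κ√θ_peak(N)}/(N+1) → ∞`) is a PHYSICAL instance;
certifying it needs the hydrodynamic limit through a shock, beyond the summit. -/
def PostShockWitness : Prop :=
  ∃ (a₀ θ₀ : T3 → ℝ) (u₀ : T3 → V3), Continuous a₀ ∧ Continuous θ₀ ∧ Continuous u₀ ∧ (∀ x, 0 < a₀ x) ∧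
    (∀ x, 0 < θ₀ x) ∧ ∀ σ₀ : ℝ, 0 < σ₀ → ∃ σ : ℝ, 0 < σ ∧ σ < σ₀ ∧ ∃ T : ℝ, 0 < T ∧
      ∃ Φ : (N : ℕ) → HardSphereFlow (Torus.geometry (Fin 3)) (hsDiameter σ N) (N + 1),
        ∀ κ : ℝ, 0 < κ → ∀ (C : ℝ) (N₀ : ℕ), ∃ N : ℕ, N₀ ≤ N ∧ ∃ t ∈ Set.Icc 0 T,
          ENNReal.ofReal C < ∫⁻ z, ENNReal.ofReal (((N : ℝ) + 1)⁻¹ * ∑ i : Fin (N + 1),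
            Real.exp (κ * ‖((Φ N).flow t z i).2‖)) ∂(localGibbsLaw σ a₀ u₀ θ₀ N (Φ N))

/-- A post-shock witness refutes K1 as typed (pure logic). -/
theorem not_expVelocityMomentBound_of_postShockWitness (hW : PostShockWitness) : ¬ ExpVelocityMomentBound := by
  rintro hK
  obtain ⟨a₀, θ₀, u₀, ha, hθ, hu, ha0, hθ0, H⟩ := hW
  obtain ⟨σ₀, hσ₀, HK⟩ := hK a₀ θ₀ u₀ ha hθ hu ha0 hθ0
  obtain ⟨σ, hσ, hσlt, T, hT, Φ, HW⟩ := H σ₀ hσ₀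
  obtain ⟨κ, hκ, C, N₀, HB⟩ := HK σ hσ hσlt T hT Φ
  obtain ⟨N, hN, t, ht, hlt⟩ := HW κ hκ C N₀
  exact absurd (HB N hN t ht) (not_le.2 hlt)

end Summit.AtomisticToContinuum.HydrodynamicLimit.Cruxes.ExpVelocityMomentBound.StrategistR1

end
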